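import Mathlib
import Literature.NumberTheory.LFunctions.ZetaClassicalRegionBounds
import Literature.NumberTheory.LFunctions.Zhang2022.Section8Lemma84LBounds
import HarnessLib

/-!
# Zhang (2022) §16 (16.10)–(16.11): the size of the prefactor `ζ(1+s+β₁)ℳ₂(d,l;1+s)/(ζ(1+s)L(1+s,χ))`
# on the three pieces of Landau's rectangle (right line, left line `Re s = −c₁/𝓛`, horizontals)

Topic `Literature/NumberTheory/LFunctions/Zhang2022` (Landau–Siegel audit tree; verdict-neutral).
Y. Zhang, *Discrete mean estimates and the Landau–Siegel zero*, arXiv:2211.02515v1 (2022)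
[Zhang2022LandauSiegel] — **an unrefereed manuscript under adjudication**; nothing here is a claim of the
manuscript. Display (16.10) [Z22 p.92, tex L4550–4556] moves the line `Re s = 1` of §16.u023 "in a way
similar to the proof of (15.15)", i.e. of Lemma 8.4 [p.47] and Lemma 8.2 [p.44]: to Landau's broken line
(left side `Re s = −c₁/𝓛` inside the zero-free regions of `ζ` and `L(·,χ)`, horizontal sides, tails of
`Re s = 1`). The kernel bookkeeping is the tree's `GaussKernelContour.norm_lineIntegral_sub_residues_le`
(+ `GaussKernelContourScales.remainder_le_eps1`); what it asks of the consumer are SUP-BOUNDS of the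
prefactor `Φ(s) = ζ(1+s+β₁)·ℳ₂(d,l;1+s)·c/(ζ(1+s)L(1+s,χ))` of (16.11) on the three pieces. This file
proves them for an ABSTRACT factor `M` (any function with `‖M(w)‖ ≤ B_M` on `Re w > 9/10`; the consumer
takes `M = ℳ₂(d,l;·)`, `B_M = C∏_{q∣dl}(1 + 900q^{−9/10})` from `Typed.Section16A.step16_u022_holds`),
an abstract constant `c` (`= d^{β₂}`) and an abstract purely imaginary shift `β_a` with `|Im β_a| ≤ 1`
(`= β₁`), under Assumption (A) for all large `D`:

* `phi1610_bounds` — there are absolute `c₁ ∈ (0, 1/12]`, `C ≥ 0`, `D₀` such that for `D ≥ D₀`,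
  `χ ≠ χ₀` with (A) `‖L(1,χ)‖ < 𝓛⁻²⁰²²` (`𝓛 = log D`): on the right line `Re s = 1` (all `t`), on the
  left line `Re s = −c₁/𝓛`, `|Im s| ≤ D/2`, and on the horizontal strips `−c₁/𝓛 ≤ Re s ≤ 1`,
  `4 ≤ |Im s| ≤ D/2`: `ζ(1+s) ≠ 0`, `L(1+s,χ) ≠ 0` and
  `‖ζ(1+s+β_a)M(1+s)c/(ζ(1+s)L(1+s,χ))‖ ≤ C·B_M·‖c‖` resp. `≤ C·𝓛⁴·B_M·‖c‖` — the hypotheses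
  `M₀ ≤ B𝓛^k`, `M₁ ≤ B𝓛^k·X^{c₁/𝓛}` (with `X = 1`), `M₂ ≤ B𝓛^k·Y^{c₁/𝓛}` of `remainder_le_eps1`
  (any height `H ∈ [4, D/2]`, e.g. `H = 𝓛²⁰`).
* the inputs are tree theorems only: `ZetaClassicalRegion.exists_zeroFreeRegion_bounds` (Titchmarsh
  (3.11.7)–(3.11.8): `ζ ≠ 0`, `ζ(w) − 1/(w−1) ≪ log`, `1/ζ ≪ log` for `Re w ≥ 1 − 4c̄/log(|Im w|+3)`),
  `Zhang2022.Lemma84.exceptional_package` (Lemma 5.5 + MV (11.10): the exceptional zero `ρ̃` and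
  `1/L(s,χ) ≪ ℒ(1 + |s−ρ̃|⁻¹)` for `σ ≥ 1 − c/ℒ`), `ZetaClassicalRegion.norm_riemannZeta_le_of_one_lt_re`,
  `…norm_inv_riemannZeta_le_of_one_lt_re`, `Lemma84.inv_LFunction_le_right`.

The same three bounds with a second factor `ζ(1+s+β_b)` are the (15.15) twin (`Eq1515`, zl-w09-p1).
Nothing about Theorems 1–2 of the manuscript or about Landau–Siegel zeros is asserted.

## References
* Y. Zhang, arXiv:2211.02515v1 (2022), §16 (16.10)–(16.11) p.92; §8 Lemma 8.2 (proof) p.44, Lemma 8.4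
  (proof) p.47; §5 Lemma 5.5. [cite: Zhang2022LandauSiegel, §16 (16.10)–(16.11) p.92]
* E. C. Titchmarsh, *The Theory of the Riemann Zeta-Function*, 2nd ed., §3.11 (3.11.7)–(3.11.8).
  [cite: Titchmarsh1986, Theorem 3.11]
* H. L. Montgomery, R. C. Vaughan, *Multiplicative Number Theory I*, CUP 2007, Thm 11.4 (11.10), §6.2.
  [cite: MontgomeryVaughan2007, Thm 11.4 (11.10)]
-/

noncomputable section

open Complex Real Set

namespace Literature.NumberTheory.LFunctions.Zhang2022.Eq1610

/-! ### Elementary facts about the pieces -/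

/-- For `D ≥ 4`: `log(D + 4) ≤ 2 log D` (`D + 4 ≤ D²`). [folklore] -/
private theorem log_add_four_le {D : ℝ} (hD : 4 ≤ D) : Real.log (D + 4) ≤ 2 * Real.log D := by
  have h : D + 4 ≤ D ^ 2 := by nlinarith
  calc Real.log (D + 4) ≤ Real.log (D ^ 2) := Real.log_le_log (by linarith) h
    _ = 2 * Real.log D := by rw [Real.log_pow]; norm_num

/-- `log(|t| + 3) ≤ 2 log D` and `log(|t| + 4) ≤ 2 log D` when `|t| ≤ D`, `D ≥ 4`. [folklore] -/
private theorem log_abs_add_le {D t : ℝ} (hD : 4 ≤ D) (ht : |t| ≤ D) :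
    Real.log (|t| + 3) ≤ 2 * Real.log D ∧ Real.log (|t| + 4) ≤ 2 * Real.log D := by
  have h4 := log_add_four_le hD
  have ht0 := abs_nonneg t
  constructor
  · exact (Real.log_le_log (by linarith) (by linarith)).trans h4
  · exact (Real.log_le_log (by linarith) (by linarith)).trans h4

/-- `M ≤ log D` for all large `D`. [folklore] -/
private theorem exists_nat_le_log (M : ℝ) : ∃ D₀ : ℕ, ∀ D : ℕ, D₀ ≤ D → M ≤ Real.log D := by
  refine ⟨⌈Real.exp M⌉₊ + 1, fun D hD => ?_⟩
  have h1 : Real.exp M ≤ D := by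
    have : (⌈Real.exp M⌉₊ : ℝ) + 1 ≤ D := by exact_mod_cast hD
    linarith [Nat.le_ceil (Real.exp M)]
  have hD0 : (0 : ℝ) < D := lt_of_lt_of_le (Real.exp_pos M) h1
  rw [Real.le_log_iff_exp_le hD0]
  exact h1

/-! ### `ζ` near the line `Re w = 1` from the classical region bounds -/

section Zeta

variable {cbar Cζ : ℝ}

/-- In the region of `ZetaClassicalRegion.exists_zeroFreeRegion_bounds`:
`‖ζ(w)‖ ≤ C log(|Im w|+3) + ‖w − 1‖⁻¹` (`w ≠ 1`). [cite: Titchmarsh1986, Theorem 3.11] -/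
theorem norm_zeta_le_of_region
    (hZ : ∀ s : ℂ, s ≠ 1 → 1 - 4 * cbar / Real.log (|s.im| + 3) ≤ s.re →
      riemannZeta s ≠ 0 ∧ ‖riemannZeta s - 1 / (s - 1)‖ ≤ Cζ * Real.log (|s.im| + 3) ∧
      ‖(riemannZeta s)⁻¹‖ ≤ Cζ * Real.log (|s.im| + 3) ∧
      ‖deriv riemannZeta s / riemannZeta s + 1 / (s - 1)‖ ≤ Cζ * Real.log (|s.im| + 3))
    {w : ℂ} (hw1 : w ≠ 1) (hreg : 1 - 4 * cbar / Real.log (|w.im| + 3) ≤ w.re) :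
    ‖riemannZeta w‖ ≤ Cζ * Real.log (|w.im| + 3) + ‖w - 1‖⁻¹ := by
  obtain ⟨-, h2, -, -⟩ := hZ w hw1 hreg
  have h := norm_add_le (riemannZeta w - 1 / (w - 1)) (1 / (w - 1))
  rw [sub_add_cancel] at h
  have h1 : ‖(1 : ℂ) / (w - 1)‖ = ‖w - 1‖⁻¹ := by rw [norm_div, norm_one, one_div]
  linarith [h1]

end Zeta

/-! ### The quotient from four factor bounds -/

/-- `‖ζ_a·M·c/(ζ₀·L)‖ ≤ A·B_M·‖c‖·B·C` from `‖ζ_a‖ ≤ A`, `‖M‖ ≤ B_M`, `‖ζ₀⁻¹‖ ≤ B`, `‖L⁻¹‖ ≤ C`.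
[folklore] -/
private theorem norm_quot_le {za z0 L Mv cst : ℂ} {A B Ci BM : ℝ}
    (hza : ‖za‖ ≤ A) (hM : ‖Mv‖ ≤ BM) (hz0 : ‖z0⁻¹‖ ≤ B) (hL : ‖L⁻¹‖ ≤ Ci)
    (hA : 0 ≤ A) (hBM : 0 ≤ BM) (hB : 0 ≤ B) :
    ‖za * Mv * cst / (z0 * L)‖ ≤ A * BM * ‖cst‖ * B * Ci := by
  rw [div_eq_mul_inv, mul_inv, norm_mul, norm_mul, norm_mul, norm_mul]
  have h1 : ‖za‖ * ‖Mv‖ ≤ A * BM := mul_le_mul hza hM (norm_nonneg _) hA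
  have h2 : ‖za‖ * ‖Mv‖ * ‖cst‖ ≤ A * BM * ‖cst‖ := mul_le_mul_of_nonneg_right h1 (norm_nonneg _)
  have h3 : ‖z0⁻¹‖ * ‖L⁻¹‖ ≤ B * Ci := mul_le_mul hz0 hL (norm_nonneg _) hB
  calc ‖za‖ * ‖Mv‖ * ‖cst‖ * (‖z0⁻¹‖ * ‖L⁻¹‖) ≤ (A * BM * ‖cst‖) * (B * Ci) :=
        mul_le_mul h2 h3 (by positivity) (by positivity)
    _ = A * BM * ‖cst‖ * B * Ci := by ring

/-! ### The three sup-bounds -/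

set_option maxHeartbeats 400000 in
/-- **The prefactor of (16.11) on Landau's rectangle.** There are absolute `c₁ ∈ (0, 1/12]`, `C ≥ 0`, `D₀`
such that for every `D ≥ D₀`, every `χ ≠ χ₀` mod `D` with (A) `‖L(1,χ)‖ < (log D)⁻²⁰²²`, every `M` with
`‖M(w)‖ ≤ B_M` on `Re w > 9/10` (`B_M ≥ 0`), every `c ∈ ℂ` and every `β_a` with `Re β_a = 0`,
`|Im β_a| ≤ 1`, writing `Φ(s) = ζ(1+s+β_a)M(1+s)c/(ζ(1+s)L(1+s,χ))` and `𝓛 = log D`: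
(i) on `Re s = 1`: `ζ(1+s) ≠ 0`, `L(1+s,χ) ≠ 0`, `‖Φ(s)‖ ≤ C·B_M·‖c‖`;
(ii) on `Re s = −c₁/𝓛`, `|Im s| ≤ D/2`: the same with `‖Φ(s)‖ ≤ C·𝓛⁴·B_M·‖c‖`;
(iii) on `−c₁/𝓛 ≤ Re s ≤ 1`, `4 ≤ |Im s| ≤ D/2`: the same with `‖Φ(s)‖ ≤ C·𝓛⁴·B_M·‖c‖`.
(The zero-free regions: Titchmarsh (3.11.7)–(3.11.8) for `ζ`, Lemma 5.5 / MV (11.10) for `L`; the left line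
stays at distance `≥ c₁/(2𝓛)` from `ρ̃` since `1 − ρ̃ ≤ K𝓛⁻²⁰²²`.) These are the inputs `M₀, M₁, M₂` of
`GaussKernelContour.norm_lineIntegral_sub_residues_le` / `remainder_le_eps1` for (16.10) (`M = ℳ₂(d,l;·)`,
`B_M = C′∏_{q∣dl}(1+900q^{−9/10})` by `step16_u022_holds`, `c = d^{β₂}`, `β_a = β₁`, any `H ∈ [4, D/2]`).
[cite: Zhang2022LandauSiegel, §16 (16.10)–(16.11) p.92] [cite: Titchmarsh1986, Theorem 3.11]
[cite: MontgomeryVaughan2007, Thm 11.4 (11.10)] -/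
theorem phi1610_bounds :
    ∃ c₁ : ℝ, 0 < c₁ ∧ c₁ ≤ 1 / 12 ∧ ∃ C : ℝ, 0 ≤ C ∧ ∃ D₀ : ℕ,
      ∀ (D : ℕ) [NeZero D] (χ : DirichletCharacter ℂ D), D₀ ≤ D → χ ≠ 1 →
        ‖χ.LFunction 1‖ < (Real.log D ^ 2022)⁻¹ →
        ∀ (M : ℂ → ℂ) (cst βa : ℂ) (BM : ℝ), 0 ≤ BM → βa.re = 0 → |βa.im| ≤ 1 →
          (∀ w : ℂ, 9 / 10 < w.re → ‖M w‖ ≤ BM) →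
          (∀ t : ℝ,
              riemannZeta (1 + ((1 : ℝ) + t * I)) ≠ 0 ∧ χ.LFunction (1 + ((1 : ℝ) + t * I)) ≠ 0 ∧
              ‖riemannZeta (1 + ((1 : ℝ) + t * I) + βa) * M (1 + ((1 : ℝ) + t * I)) * cst /
                  (riemannZeta (1 + ((1 : ℝ) + t * I)) * χ.LFunction (1 + ((1 : ℝ) + t * I)))‖ ≤
                C * BM * ‖cst‖) ∧
          (∀ t : ℝ, |t| ≤ D / 2 →
              riemannZeta (1 + ((-(c₁ / Real.log D) : ℝ) + t * I)) ≠ 0 ∧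
              χ.LFunction (1 + ((-(c₁ / Real.log D) : ℝ) + t * I)) ≠ 0 ∧
              ‖riemannZeta (1 + ((-(c₁ / Real.log D) : ℝ) + t * I) + βa) *
                    M (1 + ((-(c₁ / Real.log D) : ℝ) + t * I)) * cst /
                  (riemannZeta (1 + ((-(c₁ / Real.log D) : ℝ) + t * I)) *
                    χ.LFunction (1 + ((-(c₁ / Real.log D) : ℝ) + t * I)))‖ ≤
                C * Real.log D ^ 4 * BM * ‖cst‖) ∧
          (∀ s : ℂ, -(c₁ / Real.log D) ≤ s.re → s.re ≤ 1 → 4 ≤ |s.im| → |s.im| ≤ D / 2 →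
              riemannZeta (1 + s) ≠ 0 ∧ χ.LFunction (1 + s) ≠ 0 ∧
              ‖riemannZeta (1 + s + βa) * M (1 + s) * cst / (riemannZeta (1 + s) * χ.LFunction (1 + s))‖ ≤
                C * Real.log D ^ 4 * BM * ‖cst‖) := by
  obtain ⟨cbar, hcbar0, hcbar1, Cζ, hCζ, hZ⟩ := ZetaClassicalRegion.exists_zeroFreeRegion_bounds
  obtain ⟨cL, hcL0, hcL4, CL, hCL0, K, hK0, D₁, hLpack⟩ := Lemma84.exceptional_package
  -- the constants
  set c₁ : ℝ := min cbar (cL / 3) with hc₁def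
  have hc₁0 : 0 < c₁ := lt_min hcbar0 (by positivity)
  have hc₁bar : c₁ ≤ cbar := min_le_left _ _
  have hc₁L : c₁ ≤ cL / 3 := min_le_right _ _
  have hc₁12 : c₁ ≤ 1 / 12 := hc₁bar.trans (by linarith)
  have hc₁1 : c₁ ≤ 1 := by linarith
  obtain ⟨A₁, hA₁⟩ : ∃ A₁ : ℝ, A₁ = 2 * Cζ + 1 / c₁ + 1 := ⟨_, rfl⟩
  obtain ⟨B₁, hB₁⟩ : ∃ B₁ : ℝ, B₁ = 2 * Cζ := ⟨_, rfl⟩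
  obtain ⟨C₁, hC₁⟩ : ∃ C₁ : ℝ, C₁ = 9 * CL / c₁ + 4 * CL := ⟨_, rfl⟩
  have hA₁0 : 0 ≤ A₁ := by rw [hA₁]; positivity
  have hB₁0 : 0 ≤ B₁ := by rw [hB₁]; positivity
  have hC₁0 : 0 ≤ C₁ := by rw [hC₁]; positivity
  obtain ⟨C, hCdef⟩ : ∃ C : ℝ, C = 8 + A₁ * B₁ * C₁ := ⟨_, rfl⟩
  have hABC : 0 ≤ A₁ * B₁ * C₁ := by positivity
  have hC8 : (8 : ℝ) ≤ C := by rw [hCdef]; linarith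
  have hC0 : 0 ≤ C := by linarith
  -- the threshold
  obtain ⟨D₂, hD₂⟩ := exists_nat_le_log (max 2 (2 * K / c₁))
  refine ⟨c₁, hc₁0, hc₁12, C, hC0, max (max D₁ D₂) 4, fun D _ χ hD hχ hA M cst βa BM hBM hβa hβaim hM => ?_⟩
  have hDD₁ : D₁ ≤ D := le_trans (le_trans (le_max_left _ _) (le_max_left _ _)) hD
  have hDD₂ : D₂ ≤ D := le_trans (le_trans (le_max_right _ _) (le_max_left _ _)) hD
  have hD4 : (4 : ℝ) ≤ (D : ℝ) := by exact_mod_cast le_trans (le_max_right _ _) hD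
  obtain ⟨ℓ, hℓ'⟩ : ∃ ℓ : ℝ, Real.log D = ℓ := ⟨_, rfl⟩
  have hℓ : ℓ = Real.log D := hℓ'.symm
  have hA0 := hA
  simp only [hℓ']
  have hℓmax : max 2 (2 * K / c₁) ≤ ℓ := by have := hD₂ D hDD₂; rwa [hℓ'] at this
  have hℓ2 : 2 ≤ ℓ := le_trans (le_max_left _ _) hℓmax
  have hℓK : 2 * K / c₁ ≤ ℓ := le_trans (le_max_right _ _) hℓmax
  have hℓ0 : 0 < ℓ := by linarith
  have hℓ1 : 1 ≤ ℓ := by linarith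
  have hη0 : 0 < c₁ / ℓ := by positivity
  have hη : c₁ / ℓ ≤ 1 / 12 := by
    rw [div_le_iff₀ hℓ0]
    have := mul_le_mul hc₁12 hℓ1 (by norm_num) (by norm_num)
    linarith
  -- the exceptional zero and `1/L`
  obtain ⟨ρ, hρ1, hKρ, -, -, hLinv⟩ := hLpack D χ hDD₁ hχ hA0
  rw [hℓ'] at hKρ
  -- `1 − ρ ≤ c₁/(2ℓ)`
  have hρc : 1 - ρ ≤ c₁ / (2 * ℓ) := by
    have h1 : K * (ℓ ^ 2022)⁻¹ ≤ c₁ / (2 * ℓ) := by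
      rw [← div_eq_mul_inv, div_le_div_iff₀ (by positivity) (by positivity)]
      have h2021 : ℓ ≤ ℓ ^ 2021 := by
        calc ℓ = ℓ ^ 1 := (pow_one ℓ).symm
          _ ≤ ℓ ^ 2021 := pow_le_pow_right₀ hℓ1 (by norm_num)
      have hK' : 2 * K ≤ c₁ * ℓ := by rw [div_le_iff₀ hc₁0] at hℓK; linarith
      calc K * (2 * ℓ) = (2 * K) * ℓ := by ring
        _ ≤ (c₁ * ℓ) * ℓ ^ 2021 := mul_le_mul hK' h2021 hℓ0.le (by positivity)
        _ = c₁ * ℓ ^ 2022 := by ring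
    exact hKρ.trans h1
  -- log sizes for `|t| ≤ D`
  have hlogD : ∀ {t : ℝ}, |t| ≤ D →
      Real.log (|t| + 3) ≤ 2 * ℓ ∧ Real.log (|t| + 4) ≤ 2 * ℓ := fun ht => by
    have := log_abs_add_le hD4 ht; rwa [hℓ'] at this
  -- regions
  have hζreg : ∀ {w : ℂ}, -(c₁ / ℓ) ≤ w.re - 1 → |w.im| ≤ D →
      1 - 4 * cbar / Real.log (|w.im| + 3) ≤ w.re := by
    intro w hw hwim
    have hlog := (hlogD hwim).1
    have hlog0 : 0 < Real.log (|w.im| + 3) :=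
      lt_trans zero_lt_one (ZetaClassicalRegion.one_lt_log_abs_add_three w.im)
    have h1 : c₁ / ℓ ≤ 4 * cbar / Real.log (|w.im| + 3) := by
      rw [div_le_div_iff₀ hℓ0 hlog0]
      calc c₁ * Real.log (|w.im| + 3) ≤ c₁ * (2 * ℓ) := mul_le_mul_of_nonneg_left hlog hc₁0.le
        _ = (2 * c₁) * ℓ := by ring
        _ ≤ (4 * cbar) * ℓ := mul_le_mul_of_nonneg_right (by linarith) hℓ0.le
    linarith
  have hLreg : ∀ {s : ℂ}, -(c₁ / ℓ) ≤ s.re → |s.im| ≤ D →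
      1 - cL / (Real.log D + Real.log (|(1 + s).im| + 4)) ≤ (1 + s).re := by
    intro s hs hsim
    have him : (1 + s).im = s.im := by simp only [Complex.add_im, Complex.one_im, zero_add]
    have hre : (1 + s).re = 1 + s.re := by simp only [Complex.add_re, Complex.one_re]
    rw [him, hre]
    have hlog := (hlogD hsim).2
    have hlog0 : 0 < Real.log (|s.im| + 4) := Real.log_pos (by linarith [abs_nonneg s.im])
    have h1 : c₁ / ℓ ≤ cL / (Real.log D + Real.log (|s.im| + 4)) := by
      rw [← hℓ, div_le_div_iff₀ hℓ0 (by positivity)]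
      calc c₁ * (ℓ + Real.log (|s.im| + 4)) ≤ c₁ * (3 * ℓ) := by
            apply mul_le_mul_of_nonneg_left _ hc₁0.le; linarith
        _ = (3 * c₁) * ℓ := by ring
        _ ≤ cL * ℓ := mul_le_mul_of_nonneg_right (by linarith) hℓ0.le
    linarith
  -- the factor bounds at a point `s` with `Re s ≥ −c₁/ℓ`, `|Im s| ≤ D/2`, off `s = 0`
  -- (a) `ζ(1+s+βa)`
  have hζa : ∀ {s : ℂ}, -(c₁ / ℓ) ≤ s.re → |s.im| ≤ D / 2 → 1 + s + βa ≠ 1 →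
      ‖riemannZeta (1 + s + βa)‖ ≤ 2 * Cζ * ℓ + ‖s + βa‖⁻¹ := by
    intro s hs hsim hne
    have hwim' : (1 + s + βa).im = s.im + βa.im := by
      simp only [Complex.add_im, Complex.one_im, zero_add]
    have hwim : |(1 + s + βa).im| ≤ D := by
      rw [hwim']
      have := abs_add_le s.im βa.im
      linarith
    have hwre : -(c₁ / ℓ) ≤ (1 + s + βa).re - 1 := by
      simp only [Complex.add_re, Complex.one_re, hβa, add_zero]
      linarith
    have h := norm_zeta_le_of_region hZ hne (hζreg hwre hwim)
    have hlog := (hlogD hwim).1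
    have hinv : ‖1 + s + βa - 1‖⁻¹ = ‖s + βa‖⁻¹ := by
      congr 2; ring
    have hmul := mul_le_mul_of_nonneg_left hlog hCζ.le
    rw [hinv] at h
    linarith
  -- (b) `1/ζ(1+s)`
  have hζ0 : ∀ {s : ℂ}, -(c₁ / ℓ) ≤ s.re → |s.im| ≤ D / 2 → s ≠ 0 →
      riemannZeta (1 + s) ≠ 0 ∧ ‖(riemannZeta (1 + s))⁻¹‖ ≤ 2 * Cζ * ℓ := by
    intro s hs hsim hne
    have hne1 : 1 + s ≠ 1 := by intro h; exact hne (by linear_combination h)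
    have him : (1 + s).im = s.im := by simp only [Complex.add_im, Complex.one_im, zero_add]
    have hwim : |(1 + s).im| ≤ D := by rw [him]; linarith
    have hwre : -(c₁ / ℓ) ≤ (1 + s).re - 1 := by
      simp only [Complex.add_re, Complex.one_re]; linarith
    obtain ⟨hz, -, hinv, -⟩ := hZ (1 + s) hne1 (hζreg hwre hwim)
    have hlog := (hlogD hwim).1
    rw [him] at hinv hlog
    have hmul := mul_le_mul_of_nonneg_left hlog hCζ.le
    exact ⟨hz, hinv.trans (by linarith)⟩
  -- (c) `1/L(1+s,χ)`
  have hL0 : ∀ {s : ℂ}, -(c₁ / ℓ) ≤ s.re → |s.im| ≤ D / 2 → 1 + s ≠ (ρ : ℂ) →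
      χ.LFunction (1 + s) ≠ 0 ∧
        ‖(χ.LFunction (1 + s))⁻¹‖ ≤ 3 * CL * ℓ * (1 + ‖1 + s - ρ‖⁻¹) := by
    intro s hs hsim hne
    have hsimD : |s.im| ≤ D := by linarith
    obtain ⟨hz, hinv⟩ := hLinv (1 + s) (hLreg hs hsimD) hne
    have him : (1 + s).im = s.im := by simp only [Complex.add_im, Complex.one_im, zero_add]
    rw [him] at hinv
    have hlog := (hlogD hsimD).2
    refine ⟨hz, hinv.trans ?_⟩
    have h0 : 0 ≤ 1 + ‖1 + s - (ρ : ℂ)‖⁻¹ := by positivity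
    have hmul := mul_le_mul_of_nonneg_left hlog hCL0
    have : CL * (Real.log D + Real.log (|s.im| + 4)) ≤ 3 * CL * ℓ := by
      rw [← hℓ, mul_add]; linarith
    exact mul_le_mul_of_nonneg_right this h0
  refine ⟨?_, ?_, ?_⟩
  · -- (i) the right line `Re s = 1`
    intro t
    set s : ℂ := ((1 : ℝ) : ℂ) + t * I with hsdef
    have hsre : (1 + s).re = 2 := by simp [hsdef]; norm_num
    have hsre' : (1 + s + βa).re = 2 := by simp [hsdef, hβa]; norm_num
    have h2 : (1 : ℝ) < (1 + s).re := by rw [hsre]; norm_num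
    have h2' : (1 : ℝ) < (1 + s + βa).re := by rw [hsre']; norm_num
    have hζne : riemannZeta (1 + s) ≠ 0 := riemannZeta_ne_zero_of_one_lt_re h2
    have htwo : (2 : ℝ) / (2 - 1) = 2 := by norm_num
    have hza : ‖riemannZeta (1 + s + βa)‖ ≤ 2 := by
      have := ZetaClassicalRegion.norm_riemannZeta_le_of_one_lt_re h2'
      rwa [hsre', htwo] at this
    have hz0 : ‖(riemannZeta (1 + s))⁻¹‖ ≤ 2 := by
      have := ZetaClassicalRegion.norm_inv_riemannZeta_le_of_one_lt_re h2
      rwa [hsre, htwo] at this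
    obtain ⟨hLne, hLi⟩ := Lemma84.inv_LFunction_le_right χ one_pos (s := 1 + s) (by rw [hsre]; norm_num)
    have hLi' : ‖(χ.LFunction (1 + s))⁻¹‖ ≤ 2 := hLi.trans (by norm_num)
    have hMs : ‖M (1 + s)‖ ≤ BM := hM _ (by rw [hsre]; norm_num)
    refine ⟨hζne, hLne, ?_⟩
    have key := norm_quot_le (cst := cst) hza hMs hz0 hLi' (by norm_num) hBM (by norm_num)
    have hfin : 2 * BM * ‖cst‖ * 2 * 2 ≤ C * BM * ‖cst‖ := by
      have h0 : 0 ≤ BM * ‖cst‖ := by positivity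
      calc 2 * BM * ‖cst‖ * 2 * 2 = 8 * (BM * ‖cst‖) := by ring
        _ ≤ C * (BM * ‖cst‖) := mul_le_mul_of_nonneg_right hC8 h0
        _ = C * BM * ‖cst‖ := by ring
    exact key.trans hfin
  · -- (ii) the left line `Re s = −c₁/ℓ`
    intro t ht
    set s : ℂ := ((-(c₁ / ℓ) : ℝ) : ℂ) + t * I with hsdef
    have hsre : s.re = -(c₁ / ℓ) := by simp [hsdef]
    have hsim : s.im = t := by simp [hsdef]
    have hs0 : s ≠ 0 := by
      intro h
      have := congrArg Complex.re h
      rw [hsre, Complex.zero_re] at this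
      linarith
    have hsim' : |s.im| ≤ D / 2 := by rw [hsim]; exact ht
    -- `1 + s ≠ ρ` and the distance to `ρ`
    have hdist : c₁ / (2 * ℓ) ≤ ‖1 + s - (ρ : ℂ)‖ := by
      have hre : (1 + s - (ρ : ℂ)).re = 1 - c₁ / ℓ - ρ := by simp [hsre]; ring
      have h1 : |(1 + s - (ρ : ℂ)).re| ≤ ‖1 + s - (ρ : ℂ)‖ := Complex.abs_re_le_norm _
      rw [hre] at h1
      have h2 : c₁ / (2 * ℓ) ≤ |1 - c₁ / ℓ - ρ| := by
        rw [abs_sub_comm]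
        have : c₁ / ℓ - (1 - ρ) ≤ |ρ - (1 - c₁ / ℓ)| := by
          have := le_abs_self (ρ - (1 - c₁ / ℓ)); linarith
        have h3 : c₁ / (2 * ℓ) = c₁ / ℓ - c₁ / (2 * ℓ) := by field_simp; ring
        linarith
      exact h2.trans h1
    have hne : 1 + s ≠ (ρ : ℂ) := by
      intro h
      have : ‖1 + s - (ρ : ℂ)‖ = 0 := by rw [h, sub_self, norm_zero]
      rw [this] at hdist
      have : 0 < c₁ / (2 * ℓ) := by positivity
      linarith
    have hne1 : 1 + s + βa ≠ 1 := by
      intro h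
      have := congrArg Complex.re h
      rw [Complex.add_re, Complex.add_re, Complex.one_re, hsre, hβa] at this
      linarith
    -- the four factors
    have hza := hζa (le_of_eq hsre.symm) hsim' hne1
    have hsa : ‖s + βa‖⁻¹ ≤ ℓ / c₁ := by
      have h1 : c₁ / ℓ ≤ ‖s + βa‖ := by
        have := Complex.abs_re_le_norm (s + βa)
        simp [hsre, hβa, abs_of_pos hη0] at this
        exact this
      calc ‖s + βa‖⁻¹ ≤ (c₁ / ℓ)⁻¹ := inv_anti₀ hη0 h1
        _ = ℓ / c₁ := by rw [inv_div]
    have hza' : ‖riemannZeta (1 + s + βa)‖ ≤ A₁ * ℓ := by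
      have h1 : ℓ / c₁ = 1 / c₁ * ℓ := by ring
      have h2 : A₁ * ℓ = 2 * Cζ * ℓ + 1 / c₁ * ℓ + ℓ := by rw [hA₁]; ring
      rw [h2]; rw [h1] at hsa; linarith
    obtain ⟨hζne, hz0⟩ := hζ0 (le_of_eq hsre.symm) hsim' hs0
    have hz0' : ‖(riemannZeta (1 + s))⁻¹‖ ≤ B₁ * ℓ := by rw [hB₁]; linarith
    obtain ⟨hLne, hLi⟩ := hL0 (le_of_eq hsre.symm) hsim' hne
    have hLi' : ‖(χ.LFunction (1 + s))⁻¹‖ ≤ C₁ * ℓ ^ 2 := by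
      have hinv : ‖1 + s - (ρ : ℂ)‖⁻¹ ≤ 2 * ℓ / c₁ := by
        calc ‖1 + s - (ρ : ℂ)‖⁻¹ ≤ (c₁ / (2 * ℓ))⁻¹ := inv_anti₀ (by positivity) hdist
          _ = 2 * ℓ / c₁ := by rw [inv_div]
      have h1 : 1 + ‖1 + s - (ρ : ℂ)‖⁻¹ ≤ 3 * ℓ / c₁ := by
        have : (1 : ℝ) ≤ ℓ / c₁ := by rw [le_div_iff₀ hc₁0]; linarith
        have h3 : 3 * ℓ / c₁ = ℓ / c₁ + 2 * ℓ / c₁ := by ring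
        linarith
      calc ‖(χ.LFunction (1 + s))⁻¹‖ ≤ 3 * CL * ℓ * (1 + ‖1 + s - (ρ : ℂ)‖⁻¹) := hLi
        _ ≤ 3 * CL * ℓ * (3 * ℓ / c₁) := by gcongr
        _ = (9 * CL / c₁) * ℓ ^ 2 := by ring
        _ ≤ C₁ * ℓ ^ 2 := by
            have : 0 ≤ 4 * CL * ℓ ^ 2 := by positivity
            rw [hC₁, add_mul]; linarith
    have hMs : ‖M (1 + s)‖ ≤ BM := hM _ (by
      simp only [Complex.add_re, Complex.one_re, hsre]; linarith)
    refine ⟨hζne, hLne, ?_⟩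
    have key := norm_quot_le (cst := cst) hza' hMs hz0' hLi' (by positivity) hBM (by positivity)
    have heq : A₁ * ℓ * BM * ‖cst‖ * (B₁ * ℓ) * (C₁ * ℓ ^ 2) =
        (A₁ * B₁ * C₁) * ℓ ^ 4 * BM * ‖cst‖ := by ring
    have hfin : (A₁ * B₁ * C₁) * ℓ ^ 4 * BM * ‖cst‖ ≤ C * ℓ ^ 4 * BM * ‖cst‖ := by
      have h0 : 0 ≤ ℓ ^ 4 * BM * ‖cst‖ := by positivity
      have h1 : A₁ * B₁ * C₁ ≤ C := by rw [hCdef]; linarith only []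
      calc (A₁ * B₁ * C₁) * ℓ ^ 4 * BM * ‖cst‖ = (A₁ * B₁ * C₁) * (ℓ ^ 4 * BM * ‖cst‖) := by ring
        _ ≤ C * (ℓ ^ 4 * BM * ‖cst‖) := mul_le_mul_of_nonneg_right h1 h0
        _ = C * ℓ ^ 4 * BM * ‖cst‖ := by ring
    rw [heq] at key
    exact key.trans hfin
  · -- (iii) the horizontal strips `4 ≤ |Im s| ≤ D/2`
    intro s hsre hsre1 hsim4 hsim
    have hs0 : s ≠ 0 := by
      intro h; rw [h] at hsim4; simp at hsim4; linarith
    have him0 : s.im ≠ 0 := by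
      intro h; rw [h] at hsim4; simp at hsim4; linarith
    have hne : 1 + s ≠ (ρ : ℂ) := by
      intro h
      have := congrArg Complex.im h
      simp at this
      exact him0 this
    have hne1 : 1 + s + βa ≠ 1 := by
      intro h
      have := congrArg Complex.im h
      simp at this
      have h3 : 3 ≤ |s.im + βa.im| := by
        have := abs_add_le (s.im + βa.im) (-βa.im)
        simp only [add_neg_cancel_right, abs_neg] at this
        linarith
      rw [this] at h3; simp at h3; linarith
    have hza := hζa hsre hsim hne1
    have hsa : ‖s + βa‖⁻¹ ≤ 1 := by
      have h3 : 3 ≤ |(s + βa).im| := by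
        have : (s + βa).im = s.im + βa.im := by simp
        rw [this]
        have := abs_add_le (s.im + βa.im) (-βa.im)
        simp only [add_neg_cancel_right, abs_neg] at this
        linarith
      have h1 : (1 : ℝ) ≤ ‖s + βa‖ := le_trans (by linarith) ((Complex.abs_im_le_norm _).trans' h3)
      exact inv_le_one_of_one_le₀ h1
    have hza' : ‖riemannZeta (1 + s + βa)‖ ≤ A₁ * ℓ := by
      have h0 : 0 ≤ 1 / c₁ * ℓ := by positivity
      have h2 : A₁ * ℓ = 2 * Cζ * ℓ + 1 / c₁ * ℓ + ℓ := by rw [hA₁]; ring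
      rw [h2]; linarith
    obtain ⟨hζne, hz0⟩ := hζ0 hsre hsim hs0
    have hz0' : ‖(riemannZeta (1 + s))⁻¹‖ ≤ B₁ * ℓ := by rw [hB₁]; linarith
    obtain ⟨hLne, hLi⟩ := hL0 hsre hsim hne
    have hLi' : ‖(χ.LFunction (1 + s))⁻¹‖ ≤ C₁ * ℓ ^ 2 := by
      have hdist : (4 : ℝ) ≤ ‖1 + s - (ρ : ℂ)‖ := by
        have h1 := Complex.abs_im_le_norm (1 + s - (ρ : ℂ))
        have : (1 + s - (ρ : ℂ)).im = s.im := by simp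
        rw [this] at h1
        linarith
      have hinv : ‖1 + s - (ρ : ℂ)‖⁻¹ ≤ 1 / 4 := by
        rw [one_div]; exact inv_anti₀ (by norm_num) hdist
      calc ‖(χ.LFunction (1 + s))⁻¹‖ ≤ 3 * CL * ℓ * (1 + ‖1 + s - (ρ : ℂ)‖⁻¹) := hLi
        _ ≤ 3 * CL * ℓ * (1 + 1 / 4) := by gcongr
        _ ≤ (4 * CL) * ℓ ^ 2 := by
            have h1 : CL * ℓ ≤ CL * ℓ ^ 2 :=
              mul_le_mul_of_nonneg_left (le_self_pow₀ hℓ1 (by norm_num)) hCL0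
            have h3 : 0 ≤ CL * ℓ ^ 2 := by positivity
            linarith
        _ ≤ C₁ * ℓ ^ 2 := by
            have : 0 ≤ 9 * CL / c₁ * ℓ ^ 2 := by positivity
            rw [hC₁, add_mul]; linarith
    have hMs : ‖M (1 + s)‖ ≤ BM := hM _ (by
      simp only [Complex.add_re, Complex.one_re]; linarith)
    refine ⟨hζne, hLne, ?_⟩
    have key := norm_quot_le (cst := cst) hza' hMs hz0' hLi' (by positivity) hBM (by positivity)
    have heq : A₁ * ℓ * BM * ‖cst‖ * (B₁ * ℓ) * (C₁ * ℓ ^ 2) =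
        (A₁ * B₁ * C₁) * ℓ ^ 4 * BM * ‖cst‖ := by ring
    have hfin : (A₁ * B₁ * C₁) * ℓ ^ 4 * BM * ‖cst‖ ≤ C * ℓ ^ 4 * BM * ‖cst‖ := by
      have h0 : 0 ≤ ℓ ^ 4 * BM * ‖cst‖ := by positivity
      have h1 : A₁ * B₁ * C₁ ≤ C := by rw [hCdef]; linarith only []
      calc (A₁ * B₁ * C₁) * ℓ ^ 4 * BM * ‖cst‖ = (A₁ * B₁ * C₁) * (ℓ ^ 4 * BM * ‖cst‖) := by ring
        _ ≤ C * (ℓ ^ 4 * BM * ‖cst‖) := mul_le_mul_of_nonneg_right h1 h0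
        _ = C * ℓ ^ 4 * BM * ‖cst‖ := by ring
    rw [heq] at key
    exact key.trans hfin

/-! ### Continuity of the prefactor along the right line `Re s = 1` (for `integrable_line`) -/

/-- **The prefactor is continuous along `Re s = 1`**: if `M` is complex differentiable on `Re w > 9/10`
and `χ ≠ χ₀`, then `t ↦ ζ(2+it+β_a)M(2+it)c/(ζ(2+it)L(2+it,χ))` is continuous (`ζ`, `L` are holomorphic and
non-zero on `Re w = 2`; `ζ(2+it+β_a)` is off the pole since `Re β_a = 0`) — the input `hcont` of
`GaussKernelContour.integrable_line` / `integrable_integrand_line` at `σ₀ = 1`.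
[cite: Zhang2022LandauSiegel, §16 (16.10)–(16.11) p.92] -/
theorem continuous_phi1610_right_line {D : ℕ} [NeZero D] (χ : DirichletCharacter ℂ D) (hχ : χ ≠ 1)
    (M : ℂ → ℂ) (cst βa : ℂ) (hβa : βa.re = 0)
    (hM : DifferentiableOn ℂ M {w : ℂ | 9 / 10 < w.re}) :
    Continuous fun t : ℝ =>
      riemannZeta (1 + (((1 : ℝ) : ℂ) + t * I) + βa) * M (1 + (((1 : ℝ) : ℂ) + t * I)) * cst /
        (riemannZeta (1 + (((1 : ℝ) : ℂ) + t * I)) * χ.LFunction (1 + (((1 : ℝ) : ℂ) + t * I))) := by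
  have hline : Continuous fun t : ℝ => (1 : ℂ) + (((1 : ℝ) : ℂ) + t * I) := by fun_prop
  have hre : ∀ t : ℝ, ((1 : ℂ) + (((1 : ℝ) : ℂ) + t * I)).re = 2 := fun t => by simp; norm_num
  have hre' : ∀ t : ℝ, ((1 : ℂ) + (((1 : ℝ) : ℂ) + t * I) + βa).re = 2 := fun t => by
    simp [hβa]; norm_num
  refine continuous_iff_continuousAt.mpr fun t => ?_
  have h1 : (1 : ℝ) < ((1 : ℂ) + (((1 : ℝ) : ℂ) + t * I)).re := by rw [hre]; norm_num
  have hne1 : (1 : ℂ) + (((1 : ℝ) : ℂ) + t * I) ≠ 1 := by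
    intro h; have := congrArg Complex.re h; rw [hre] at this; norm_num at this
  have hne1' : (1 : ℂ) + (((1 : ℝ) : ℂ) + t * I) + βa ≠ 1 := by
    intro h; have := congrArg Complex.re h; rw [hre'] at this; norm_num at this
  -- the four factors are continuous at `t`
  have cζa : ContinuousAt (fun t : ℝ => riemannZeta (1 + (((1 : ℝ) : ℂ) + t * I) + βa)) t :=
    (differentiableAt_riemannZeta hne1').continuousAt.comp
      (f := fun t : ℝ => (1 : ℂ) + (((1 : ℝ) : ℂ) + t * I) + βa) (by fun_prop)
  have cζ : ContinuousAt (fun t : ℝ => riemannZeta (1 + (((1 : ℝ) : ℂ) + t * I))) t :=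
    (differentiableAt_riemannZeta hne1).continuousAt.comp (f := fun t : ℝ => (1 : ℂ) + (((1 : ℝ) : ℂ) + t * I))
      hline.continuousAt
  have cL : ContinuousAt (fun t : ℝ => χ.LFunction (1 + (((1 : ℝ) : ℂ) + t * I))) t :=
    ((DirichletCharacter.differentiable_LFunction hχ).continuous.comp hline).continuousAt
  have cM : ContinuousAt (fun t : ℝ => M (1 + (((1 : ℝ) : ℂ) + t * I))) t := by
    have hmem : (1 : ℂ) + (((1 : ℝ) : ℂ) + t * I) ∈ {w : ℂ | 9 / 10 < w.re} := by
      show (9 / 10 : ℝ) < ((1 : ℂ) + (((1 : ℝ) : ℂ) + t * I)).re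
      rw [hre]; norm_num
    have hMat : ContinuousAt M ((1 : ℂ) + (((1 : ℝ) : ℂ) + t * I)) :=
      (hM.differentiableAt ((Complex.continuous_re.isOpen_preimage _ isOpen_Ioi).mem_nhds hmem)).continuousAt
    exact ContinuousAt.comp (f := fun t : ℝ => (1 : ℂ) + (((1 : ℝ) : ℂ) + t * I)) hMat hline.continuousAt
  -- the denominators do not vanish
  have hζne : riemannZeta (1 + (((1 : ℝ) : ℂ) + t * I)) ≠ 0 := riemannZeta_ne_zero_of_one_lt_re h1
  have hLne : χ.LFunction (1 + (((1 : ℝ) : ℂ) + t * I)) ≠ 0 :=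
    (Lemma84.inv_LFunction_le_right χ one_pos (s := 1 + (((1 : ℝ) : ℂ) + t * I))
      (by rw [hre]; norm_num)).1
  exact ((cζa.mul cM).mul continuousAt_const).div (cζ.mul cL) (mul_ne_zero hζne hLne)

end Literature.NumberTheory.LFunctions.Zhang2022.Eq1610
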